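import Summits.QuantumFields.YangMills.Theorems.ForcedResponseSkewnessRunningCouplingCeilingCovAxisDomination
import Summits.QuantumFields.YangMills.Theorems.ForcedResponseSkewnessRunningCouplingCeilingUniformSmearPrep
import HarnessLib

/-!
# Route `ForcedResponseSkewness`, crux `RunningCouplingCeiling` ⟨stmt-QuantumFields-24275⟩ — the smeared two-point function
# `Q2(θv, v)` at ONE lattice spacing is bounded by the symmetrised ON-AXIS coupling over the support window (scalewise smearing)

Helper file (`--supports stmt-QuantumFields-24275`; free-hands seat `ym-line-frs-p2` g20; sequel of `…RunningCouplingCeilingCovAxisDomination`).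
Definition-free, 0 sorry, standard axioms.  No item is closed; no summit, no crux and no mass gap is proved by this file.

WHAT.  Write `G(t) = (2t)⁸·lCC(Q^θ,Q,2t)`, `G'(t) = (2t)⁸·lCC(Q,Q^θ,2t)` for the two reflection orders of the dimensionless on-axis
coupling (`lCC = latticeConnectedCorr r.ρ β (2L+1)`).  For two real test functions `f, g` charged only at times in `[−M, −m]` resp.
`[m, M]` (`0 < m`), a spacing `s` with `3s ≤ 2m`, a torus with `M/s + 2 ≤ L`, and a common bound `B ≥ 0` on `G(t), G'(t)` for ALL
heights `t` in the window `[m/s − 1, M/s + 1]`: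

* `pair_le`, ★ `Q2_le_of_axis_window` (§1): `Q2_{β,L,s}(f,g) ≤ (s/m)⁸ · B · (Σ_x |f(sx)|)(Σ_y |g(sy)|)` (✓`abs_torusCov_le_of_axis_bounds`
  at time separation `n = y₀ − x₀ ∈ [2m/s, 2M/s]`, `n − 1 ≥ m/s`);
* ★ `Q2_thetaTest_le_of_axis_window` (§2): the crux's letters — `f = θv`, `g = v`, `tsupport v ⊆ closedBall p ρ₀`, `ρ₀ < p₀`,
  `m = p₀ − ρ₀`, `M = p₀ + ρ₀`;
* ★ `Q2_thetaTest_le_scalewise` (§3): for an `L¹`-normalised source (`∫|v| ≤ 1`) there is `s₀ = s₀(v) > 0` with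
  `Q2_{β,L,s}(θv,v) ≤ 4B/(p₀ − ρ₀)⁸` for all `0 < s ≤ s₀`, `β ≥ 0`, tori `(‖p‖+|ρ₀|)/s + 2 ≤ L` (lattice Riemann sums
  ✓`exists_latticeSum_abs_le`; the crux's `∃ β₆ Λ₆` sits after `∀ v ∀ Λ`, so the `v`-dependence of `s₀` is admissible);
* ★ `exists_axis_floor_of_Q2_floor` (§4): contrapositive — a FLOOR `ε ≤ Q2_{β,L,s}(f,g)` forces a height `t` in the window with
  `G(t) > B` or `G'(t) > B` whenever `(s/m)⁸ B (Σ|f|)(Σ|g|) < ε`; ★ `exists_axis_floor`: the clause-(i) floor of the crux transported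
  to the axis — `∃ m ≤ M, η > 0`, eventually in `β`, on all large tori SOME height `t ∈ [m/a(β) − 1, M/a(β) + 1]` has `max(G,G')(t) > η`.

[cite: OsterwalderSeiler1978, §2]; [cite: OS1973, §2].  HONEST LABEL: soft transfer lemmas (reflection positivity + bookkeeping);
`MoebiusRow` (XL) / `CrossoverDecay` (L–XL), ⟨24275⟩, ⟨23763⟩, ⟨26871⟩ OPEN; the Yang–Mills mass gap is NOT proved; no summit is proved by a line.
-/

set_option autoImplicit false
noncomputable section

open Set Metric MeasureTheory Filter Topology
open scoped SchwartzMap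
open Literature.MathematicalPhysics.QuantumFieldTheory Literature.MathematicalPhysics.QuantumLattice
open Literature.Probability.LatticeModels
open Summit.QuantumFields.YangMills.Cruxes.OSLegsFromFemtoAndGap.DlrCollarTransfer
open Summit.QuantumFields.YangMills.Cruxes.RunningCouplingCeiling.Pointwise (torusCov Q2_eq_sum_torusCov exists_latticeSum_abs_le)
open Summit.QuantumFields.YangMills.Cruxes.NT.CeilingPrice (integral_abs_thetaTest)
open Summit.QuantumFields.YangMills.Cruxes.NT.Reference (tsupport_thetaTest_subset_closedBall_zero)
open Summit.QuantumFields.YangMills.Theorems.ForcedResponseSkewnessRunningCouplingCeilingCovAxisDomination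
  (abs_torusCov_le_of_axis_bounds)

namespace Summit.QuantumFields.YangMills.Theorems.ForcedResponseSkewnessRunningCouplingCeilingSmearScalewise

variable {G : Type} [Group G] [TopologicalSpace G] [IsTopologicalGroup G] [CompactSpace G]
  [MeasurableSpace G] [BorelSpace G]

/-! ## §1 Scalewise smearing against a time-separated pair of sources -/

/-- **Per-pair bound.**  For sources `f`, `g` charged at times in `[−M,−m]` resp. `[m,M]`, a spacing `3s ≤ 2m`, a torus
`M/s + 2 ≤ L`, `β ≥ 0` and a common bound `B ≥ 0` on both on-axis orders over the window `[m/s − 1, M/s + 1]`: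
`f(sx) g(sy) torusCov(x,y) ≤ |f(sx)| |g(sy)| (s/m)⁸ B`. [cite: OsterwalderSeiler1978, §2] -/
theorem pair_le (r : LatticeRep G) {β : ℝ} (hβ : 0 ≤ β) (L : ℕ) {s m M : ℝ} (hs : 0 < s) (hm : 0 < m)
    (f g : 𝓢(EuclideanSpace ℝ (Fin 4), ℝ))
    (hf : ∀ w : EuclideanSpace ℝ (Fin 4), f w ≠ 0 → -M ≤ w 0 ∧ w 0 ≤ -m)
    (hg : ∀ w : EuclideanSpace ℝ (Fin 4), g w ≠ 0 → m ≤ w 0 ∧ w 0 ≤ M)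
    (hsm : 3 * s ≤ 2 * m) (hL : M / s + 2 ≤ (L : ℝ)) {B : ℝ} (hB : 0 ≤ B)
    (hwin : ∀ t : ℕ, m / s - 1 ≤ (t : ℝ) → (t : ℝ) ≤ M / s + 1 →
      ((2 * t : ℕ) : ℝ) ^ 8 * latticeConnectedCorr r.ρ β (2 * L + 1) r.curvature.timeReflect.F r.curvature.F (2 * t) ≤ B ∧
      ((2 * t : ℕ) : ℝ) ^ 8 * latticeConnectedCorr r.ρ β (2 * L + 1) r.curvature.F r.curvature.timeReflect.F (2 * t) ≤ B)
    (x y : Fin 4 → ℤ) :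
    f (s • siteToE x) * g (s • siteToE y) * torusCov G r β L x y ≤
      |f (s • siteToE x)| * |g (s • siteToE y)| * ((s / m) ^ 8 * B) := by
  by_cases hfx : f (s • siteToE x) = 0
  · simp [hfx]
  by_cases hgy : g (s • siteToE y) = 0
  · simp [hgy]
  obtain ⟨hx1, hx2⟩ := hf _ hfx
  obtain ⟨hy1, hy2⟩ := hg _ hgy
  have ex : (s • siteToE x) 0 = s * (x 0 : ℝ) := by simp
  have ey : (s • siteToE y) 0 = s * (y 0 : ℝ) := by simp
  rw [ex] at hx1 hx2
  rw [ey] at hy1 hy2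
  -- the integer time separation `n = y₀ − x₀ ∈ [2m/s, 2M/s]`
  have hlow : 2 * m ≤ s * ((y 0 : ℝ) - x 0) := by nlinarith
  have hup : s * ((y 0 : ℝ) - x 0) ≤ 2 * M := by nlinarith
  have hms : 3 / 2 ≤ m / s := by rw [le_div_iff₀ hs]; linarith
  have hdpos : (0 : ℝ) < (y 0 : ℝ) - x 0 := by
    by_contra h
    rw [not_lt] at h
    nlinarith
  have hint_pos : (0 : ℤ) < y 0 - x 0 := by
    have : (0 : ℝ) < ((y 0 - x 0 : ℤ) : ℝ) := by push_cast; exact hdpos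
    exact_mod_cast this
  obtain ⟨n, hn⟩ : ∃ n : ℕ, y 0 - x 0 = (n : ℤ) := ⟨(y 0 - x 0).toNat, (Int.toNat_of_nonneg hint_pos.le).symm⟩
  have hnR : (n : ℝ) = (y 0 : ℝ) - x 0 := by
    have : ((n : ℤ) : ℝ) = ((y 0 - x 0 : ℤ) : ℝ) := by rw [hn]
    push_cast at this
    linarith
  have hn_low : 2 * (m / s) ≤ (n : ℝ) := by
    rw [hnR, show 2 * (m / s) = 2 * m / s by ring, div_le_iff₀ hs]; linarith
  have hn_up : (n : ℝ) ≤ 2 * (M / s) := by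
    rw [hnR, show 2 * (M / s) = 2 * M / s by ring, le_div_iff₀ hs]; linarith
  have hn3 : 3 ≤ n := by
    have : (3 : ℝ) ≤ n := by linarith
    exact_mod_cast this
  have hnL : n / 2 + 2 ≤ L := by
    have h1 : ((n / 2 : ℕ) : ℝ) ≤ (n : ℝ) / 2 := by
      have : ((n / 2 : ℕ) : ℝ) * 2 ≤ n := by exact_mod_cast Nat.div_mul_le_self n 2
      linarith
    have h2 : ((n / 2 : ℕ) : ℝ) + 2 ≤ (L : ℝ) := by linarith
    exact_mod_cast h2
  -- both window heights `⌊n/2⌋`, `⌈n/2⌉` lie in `[m/s − 1, M/s + 1]`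
  have hwin' : ∀ t : ℕ, n - 1 ≤ 2 * t → 2 * t ≤ n + 1 → m / s - 1 ≤ (t : ℝ) ∧ (t : ℝ) ≤ M / s + 1 := by
    intro t h1 h2
    have h1' : (n : ℝ) - 1 ≤ 2 * t := by
      have : ((n - 1 : ℕ) : ℝ) ≤ ((2 * t : ℕ) : ℝ) := by exact_mod_cast h1
      rwa [Nat.cast_sub (by omega), Nat.cast_one, Nat.cast_mul, Nat.cast_two] at this
    have h2' : 2 * (t : ℝ) ≤ n + 1 := by exact_mod_cast h2
    constructor <;> linarith
  obtain ⟨hG, -⟩ := hwin (n / 2) (hwin' _ (by omega) (by omega)).1 (hwin' _ (by omega) (by omega)).2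
  obtain ⟨-, hG'⟩ := hwin ((n + 1) / 2) (hwin' _ (by omega) (by omega)).1 (hwin' _ (by omega) (by omega)).2
  have hcov := abs_torusCov_le_of_axis_bounds r hβ L n hn3 hnL x y (Or.inl hn) hB hG hG'
  -- `(n − 1)⁸ ≥ (m/s)⁸`
  have hms1 : m / s ≤ (n : ℝ) - 1 := by linarith
  have hms0 : 0 < m / s := div_pos hm hs
  have hcov' : |torusCov G r β L x y| ≤ (s / m) ^ 8 * B := by
    refine hcov.trans ?_
    rw [div_le_iff₀ (pow_pos (hms0.trans_le hms1) 8)]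
    calc B = (s / m) ^ 8 * B * (m / s) ^ 8 := by
          rw [show (s / m) ^ 8 * B * (m / s) ^ 8 = B * ((s / m) * (m / s)) ^ 8 by ring,
            show (s / m) * (m / s) = 1 by field_simp, one_pow, mul_one]
      _ ≤ (s / m) ^ 8 * B * ((n : ℝ) - 1) ^ 8 :=
          mul_le_mul_of_nonneg_left (pow_le_pow_left₀ hms0.le hms1 8) (by positivity)
  calc f (s • siteToE x) * g (s • siteToE y) * torusCov G r β L x y
      ≤ |f (s • siteToE x) * g (s • siteToE y) * torusCov G r β L x y| := le_abs_self _
    _ = |f (s • siteToE x)| * |g (s • siteToE y)| * |torusCov G r β L x y| := by rw [abs_mul, abs_mul]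
    _ ≤ _ := mul_le_mul_of_nonneg_left hcov' (mul_nonneg (abs_nonneg _) (abs_nonneg _))

/-- ★ **Scalewise smearing.**  Under the hypotheses of `pair_le`:
`Q2_{β,L,s}(f,g) ≤ (s/m)⁸ · B · (Σ_x |f(sx)|)(Σ_y |g(sy)|)`. [cite: OsterwalderSeiler1978, §2] -/
theorem Q2_le_of_axis_window (r : LatticeRep G) {β : ℝ} (hβ : 0 ≤ β) (L : ℕ) {s m M : ℝ} (hs : 0 < s) (hm : 0 < m)
    (f g : 𝓢(EuclideanSpace ℝ (Fin 4), ℝ))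
    (hf : ∀ w : EuclideanSpace ℝ (Fin 4), f w ≠ 0 → -M ≤ w 0 ∧ w 0 ≤ -m)
    (hg : ∀ w : EuclideanSpace ℝ (Fin 4), g w ≠ 0 → m ≤ w 0 ∧ w 0 ≤ M)
    (hsm : 3 * s ≤ 2 * m) (hL : M / s + 2 ≤ (L : ℝ)) {B : ℝ} (hB : 0 ≤ B)
    (hwin : ∀ t : ℕ, m / s - 1 ≤ (t : ℝ) → (t : ℝ) ≤ M / s + 1 →
      ((2 * t : ℕ) : ℝ) ^ 8 * latticeConnectedCorr r.ρ β (2 * L + 1) r.curvature.timeReflect.F r.curvature.F (2 * t) ≤ B ∧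
      ((2 * t : ℕ) : ℝ) ^ 8 * latticeConnectedCorr r.ρ β (2 * L + 1) r.curvature.F r.curvature.timeReflect.F (2 * t) ≤ B) :
    Q2 G r β L s f g ≤
      (s / m) ^ 8 * B * ((∑ x ∈ box 4 L, |f (s • siteToE x)|) * ∑ y ∈ box 4 L, |g (s • siteToE y)|) := by
  rw [Q2_eq_sum_torusCov]
  calc ∑ x ∈ box 4 L, ∑ y ∈ box 4 L, f (s • siteToE x) * g (s • siteToE y) * torusCov G r β L x y
      ≤ ∑ x ∈ box 4 L, ∑ y ∈ box 4 L, |f (s • siteToE x)| * |g (s • siteToE y)| * ((s / m) ^ 8 * B) :=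
        Finset.sum_le_sum fun x _ => Finset.sum_le_sum fun y _ =>
          pair_le r hβ L hs hm f g hf hg hsm hL hB hwin x y
    _ = (s / m) ^ 8 * B * ∑ x ∈ box 4 L, ∑ y ∈ box 4 L, |f (s • siteToE x)| * |g (s • siteToE y)| := by
        rw [Finset.mul_sum]
        refine Finset.sum_congr rfl fun x _ => ?_
        rw [Finset.mul_sum]
        refine Finset.sum_congr rfl fun y _ => ?_
        ring
    _ = _ := by rw [Finset.sum_mul_sum]

/-! ## §2 The crux's letters: `θv` against `v` in a positive-time ball -/

/-- Charged points of a source supported in `closedBall p ρ₀` have time coordinate in `[p₀ − ρ₀, p₀ + ρ₀]`. [folklore] -/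
theorem time_mem_of_ne_zero {v : 𝓢(EuclideanSpace ℝ (Fin 4), ℝ)} {p : EuclideanSpace ℝ (Fin 4)} {ρ₀ : ℝ}
    (hv : tsupport (v : EuclideanSpace ℝ (Fin 4) → ℝ) ⊆ closedBall p ρ₀) {w : EuclideanSpace ℝ (Fin 4)} (hw : v w ≠ 0) :
    p 0 - ρ₀ ≤ w 0 ∧ w 0 ≤ p 0 + ρ₀ := by
  have hmem : w ∈ closedBall p ρ₀ := hv (subset_tsupport _ (Function.mem_support.2 hw))
  rw [mem_closedBall, dist_eq_norm] at hmem
  have h0 : |(w - p) 0| ≤ ρ₀ := by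
    have := PiLp.norm_apply_le (w - p) (0 : Fin 4)
    rw [Real.norm_eq_abs] at this
    exact this.trans hmem
  rw [PiLp.sub_apply, abs_le] at h0
  constructor <;> linarith [h0.1, h0.2]

/-- ★ **Scalewise smearing in the crux's letters.**  For a real Schwartz `v` with `tsupport v ⊆ closedBall p ρ₀`, `ρ₀ < p₀`, a spacing
`3s ≤ 2(p₀ − ρ₀)`, a torus `(p₀ + ρ₀)/s + 2 ≤ L`, `β ≥ 0`, and `B ≥ 0` bounding both on-axis orders at every height
`t ∈ [(p₀−ρ₀)/s − 1, (p₀+ρ₀)/s + 1]`: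
`Q2_{β,L,s}(θv, v) ≤ (s/(p₀−ρ₀))⁸ · B · (Σ_x |θv(sx)|)(Σ_y |v(sy)|)`. [cite: OS1973, §2] [cite: OsterwalderSeiler1978, §2] -/
theorem Q2_thetaTest_le_of_axis_window (r : LatticeRep G) {β : ℝ} (hβ : 0 ≤ β) (L : ℕ) {s : ℝ} (hs : 0 < s)
    (v : 𝓢(EuclideanSpace ℝ (Fin 4), ℝ)) {p : EuclideanSpace ℝ (Fin 4)} {ρ₀ : ℝ}
    (hv : tsupport (v : EuclideanSpace ℝ (Fin 4) → ℝ) ⊆ closedBall p ρ₀) (hρ : ρ₀ < p 0)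
    (hsm : 3 * s ≤ 2 * (p 0 - ρ₀)) (hL : (p 0 + ρ₀) / s + 2 ≤ (L : ℝ)) {B : ℝ} (hB : 0 ≤ B)
    (hwin : ∀ t : ℕ, (p 0 - ρ₀) / s - 1 ≤ (t : ℝ) → (t : ℝ) ≤ (p 0 + ρ₀) / s + 1 →
      ((2 * t : ℕ) : ℝ) ^ 8 * latticeConnectedCorr r.ρ β (2 * L + 1) r.curvature.timeReflect.F r.curvature.F (2 * t) ≤ B ∧
      ((2 * t : ℕ) : ℝ) ^ 8 * latticeConnectedCorr r.ρ β (2 * L + 1) r.curvature.F r.curvature.timeReflect.F (2 * t) ≤ B) :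
    Q2 G r β L s (thetaTest 4 v) v ≤
      (s / (p 0 - ρ₀)) ^ 8 * B *
        ((∑ x ∈ box 4 L, |thetaTest 4 v (s • siteToE x)|) * ∑ y ∈ box 4 L, |v (s • siteToE y)|) := by
  have hm : 0 < p 0 - ρ₀ := sub_pos.2 hρ
  refine Q2_le_of_axis_window r hβ L hs hm (thetaTest 4 v) v (M := p 0 + ρ₀) ?_ ?_ hsm hL hB hwin
  · intro w hw
    rw [thetaTest_apply] at hw
    obtain ⟨h1, h2⟩ := time_mem_of_ne_zero hv hw
    have h0 : timeReflection 4 w 0 = -w 0 := by simp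
    rw [h0] at h1 h2
    constructor <;> linarith
  · intro w hw
    exact time_mem_of_ne_zero hv hw

/-! ## §3 The normalised scalewise ceiling -/

/-- ★ **Scalewise ceiling for an `L¹`-normalised source** (`∫|v| ≤ 1`, `tsupport v ⊆ closedBall p ρ₀`, `ρ₀ < p₀`): there is
`s₀ = s₀(v) > 0` such that for all `0 < s ≤ s₀`, all tori with `(‖p‖ + |ρ₀|)/s + 2 ≤ L`, all `β ≥ 0` and all `B ≥ 0` bounding both
on-axis orders at every height of the window `[(p₀−ρ₀)/s − 1, (p₀+ρ₀)/s + 1]`:  `Q2_{β,L,s}(θv, v) ≤ 4B/(p₀ − ρ₀)⁸`.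
[cite: OS1973, §2] [cite: OsterwalderSeiler1978, §2] -/
theorem Q2_thetaTest_le_scalewise (r : LatticeRep G) (v : 𝓢(EuclideanSpace ℝ (Fin 4), ℝ)) {p : EuclideanSpace ℝ (Fin 4)} {ρ₀ : ℝ}
    (hv : tsupport (v : EuclideanSpace ℝ (Fin 4) → ℝ) ⊆ closedBall p ρ₀) (hρ : ρ₀ < p 0) (hint : (∫ y, |v y|) ≤ 1) :
    ∃ s₀ : ℝ, 0 < s₀ ∧ ∀ s : ℝ, 0 < s → s ≤ s₀ → ∀ L : ℕ, (‖p‖ + |ρ₀|) / s + 2 ≤ (L : ℝ) →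
      ∀ β : ℝ, 0 ≤ β → ∀ B : ℝ, 0 ≤ B →
        (∀ t : ℕ, (p 0 - ρ₀) / s - 1 ≤ (t : ℝ) → (t : ℝ) ≤ (p 0 + ρ₀) / s + 1 →
          ((2 * t : ℕ) : ℝ) ^ 8 * latticeConnectedCorr r.ρ β (2 * L + 1) r.curvature.timeReflect.F r.curvature.F (2 * t) ≤ B ∧
          ((2 * t : ℕ) : ℝ) ^ 8 * latticeConnectedCorr r.ρ β (2 * L + 1) r.curvature.F r.curvature.timeReflect.F (2 * t) ≤ B) →
        Q2 G r β L s (thetaTest 4 v) v ≤ 4 * B / (p 0 - ρ₀) ^ 8 := by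
  have hm : 0 < p 0 - ρ₀ := sub_pos.2 hρ
  set R : ℝ := ‖p‖ + |ρ₀| with hR_def
  have hp0 : p 0 ≤ ‖p‖ := by
    have := PiLp.norm_apply_le p (0 : Fin 4)
    rw [Real.norm_eq_abs] at this
    exact (le_abs_self _).trans this
  have hMR : p 0 + ρ₀ ≤ R := by rw [hR_def]; linarith [le_abs_self ρ₀]
  have hvR : tsupport (v : EuclideanSpace ℝ (Fin 4) → ℝ) ⊆ closedBall 0 R :=
    hv.trans (closedBall_subset_closedBall' (by rw [dist_zero_right, hR_def]; linarith [le_abs_self ρ₀]))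
  have hθvR : tsupport (thetaTest 4 v : EuclideanSpace ℝ (Fin 4) → ℝ) ⊆ closedBall 0 R :=
    tsupport_thetaTest_subset_closedBall_zero hvR
  obtain ⟨s₁, hs₁, h₁⟩ := exists_latticeSum_abs_le v hvR
  obtain ⟨s₂, hs₂, h₂⟩ := exists_latticeSum_abs_le (thetaTest 4 v) hθvR
  have hθint : (∫ y, |thetaTest 4 v y|) ≤ 1 := by rw [integral_abs_thetaTest]; exact hint
  refine ⟨min (min s₁ s₂) (2 * (p 0 - ρ₀) / 3), lt_min (lt_min hs₁ hs₂) (by positivity), ?_⟩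
  intro s hs hss₀ L hL β hβ B hB hwin
  have hss₁ : s ≤ s₁ := hss₀.trans ((min_le_left _ _).trans (min_le_left _ _))
  have hss₂ : s ≤ s₂ := hss₀.trans ((min_le_left _ _).trans (min_le_right _ _))
  have hsm : 3 * s ≤ 2 * (p 0 - ρ₀) := by
    have := hss₀.trans (min_le_right _ _)
    rw [le_div_iff₀ (by norm_num : (0:ℝ) < 3)] at this
    linarith
  have hRL : R ≤ s * L := by
    have h1 : R / s ≤ (L : ℝ) := by linarith
    rwa [div_le_iff₀ hs, mul_comm] at h1
  have hL' : (p 0 + ρ₀) / s + 2 ≤ (L : ℝ) :=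
    le_trans (by gcongr) hL
  have hmain := Q2_thetaTest_le_of_axis_window r hβ L hs v hv hρ hsm hL' hB hwin
  -- Riemann factors `s⁴ Σ|v(sx)| ≤ 2`, `s⁴ Σ|θv(sx)| ≤ 2`
  have hX : s ^ 4 * ∑ y ∈ box 4 L, |v (s • siteToE y)| ≤ 2 := (h₁ s hs hss₁ L hRL).trans (by linarith)
  have hY : s ^ 4 * ∑ x ∈ box 4 L, |thetaTest 4 v (s • siteToE x)| ≤ 2 := (h₂ s hs hss₂ L hRL).trans (by linarith)
  have hX0 : 0 ≤ ∑ y ∈ box 4 L, |v (s • siteToE y)| := Finset.sum_nonneg fun _ _ => abs_nonneg _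
  have hY0 : 0 ≤ ∑ x ∈ box 4 L, |thetaTest 4 v (s • siteToE x)| := Finset.sum_nonneg fun _ _ => abs_nonneg _
  have hprod : (s ^ 4 * ∑ x ∈ box 4 L, |thetaTest 4 v (s • siteToE x)|) * (s ^ 4 * ∑ y ∈ box 4 L, |v (s • siteToE y)|) ≤ 4 := by
    calc (s ^ 4 * ∑ x ∈ box 4 L, |thetaTest 4 v (s • siteToE x)|) * (s ^ 4 * ∑ y ∈ box 4 L, |v (s • siteToE y)|)
        ≤ 2 * 2 := mul_le_mul hY hX (by positivity) (by norm_num)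
      _ = 4 := by norm_num
  refine hmain.trans ?_
  have hs8 : 0 < s ^ 8 := by positivity
  calc (s / (p 0 - ρ₀)) ^ 8 * B *
        ((∑ x ∈ box 4 L, |thetaTest 4 v (s • siteToE x)|) * ∑ y ∈ box 4 L, |v (s • siteToE y)|)
      = B / (p 0 - ρ₀) ^ 8 *
          ((s ^ 4 * ∑ x ∈ box 4 L, |thetaTest 4 v (s • siteToE x)|) * (s ^ 4 * ∑ y ∈ box 4 L, |v (s • siteToE y)|)) := by
        rw [div_pow]; ring
    _ ≤ B / (p 0 - ρ₀) ^ 8 * 4 := mul_le_mul_of_nonneg_left hprod (by positivity)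
    _ = 4 * B / (p 0 - ρ₀) ^ 8 := by ring

/-! ## §4 Floors move to the axis -/

/-- ★ **A smeared floor forces an axis value above `B` in the window** (contrapositive of `Q2_le_of_axis_window`).
[cite: OsterwalderSeiler1978, §2] -/
theorem exists_axis_floor_of_Q2_floor (r : LatticeRep G) {β : ℝ} (hβ : 0 ≤ β) (L : ℕ) {s m M : ℝ} (hs : 0 < s) (hm : 0 < m)
    (f g : 𝓢(EuclideanSpace ℝ (Fin 4), ℝ))
    (hf : ∀ w : EuclideanSpace ℝ (Fin 4), f w ≠ 0 → -M ≤ w 0 ∧ w 0 ≤ -m)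
    (hg : ∀ w : EuclideanSpace ℝ (Fin 4), g w ≠ 0 → m ≤ w 0 ∧ w 0 ≤ M)
    (hsm : 3 * s ≤ 2 * m) (hL : M / s + 2 ≤ (L : ℝ)) {B : ℝ} (hB : 0 ≤ B) {X ε : ℝ}
    (hX : (∑ x ∈ box 4 L, |f (s • siteToE x)|) * (∑ y ∈ box 4 L, |g (s • siteToE y)|) ≤ X)
    (hε : ε ≤ Q2 G r β L s f g) (hBε : (s / m) ^ 8 * B * X < ε) :
    ∃ t : ℕ, m / s - 1 ≤ (t : ℝ) ∧ (t : ℝ) ≤ M / s + 1 ∧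
      (B < ((2 * t : ℕ) : ℝ) ^ 8 * latticeConnectedCorr r.ρ β (2 * L + 1) r.curvature.timeReflect.F r.curvature.F (2 * t) ∨
       B < ((2 * t : ℕ) : ℝ) ^ 8 * latticeConnectedCorr r.ρ β (2 * L + 1) r.curvature.F r.curvature.timeReflect.F (2 * t)) := by
  by_contra hcon
  push Not at hcon
  have hwin : ∀ t : ℕ, m / s - 1 ≤ (t : ℝ) → (t : ℝ) ≤ M / s + 1 →
      ((2 * t : ℕ) : ℝ) ^ 8 * latticeConnectedCorr r.ρ β (2 * L + 1) r.curvature.timeReflect.F r.curvature.F (2 * t) ≤ B ∧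
      ((2 * t : ℕ) : ℝ) ^ 8 * latticeConnectedCorr r.ρ β (2 * L + 1) r.curvature.F r.curvature.timeReflect.F (2 * t) ≤ B :=
    fun t h1 h2 => hcon t h1 h2
  have h := Q2_le_of_axis_window r hβ L hs hm f g hf hg hsm hL hB hwin
  have h' : (s / m) ^ 8 * B * ((∑ x ∈ box 4 L, |f (s • siteToE x)|) * ∑ y ∈ box 4 L, |g (s • siteToE y)|) ≤
      (s / m) ^ 8 * B * X := mul_le_mul_of_nonneg_left hX (by positivity)
  linarith

/-- **Time window of a compactly supported positive-time source**: there are `0 < m ≤ M` with `m ≤ w₀ ≤ M` at every charged point and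
`tsupport v ⊆ closedBall 0 M`. [folklore] -/
theorem exists_time_window_of_hasCompactSupport (v : 𝓢(EuclideanSpace ℝ (Fin 4), ℝ))
    (hc : HasCompactSupport (v : EuclideanSpace ℝ (Fin 4) → ℝ))
    (hpos : tsupport (v : EuclideanSpace ℝ (Fin 4) → ℝ) ⊆ {y : EuclideanSpace ℝ (Fin 4) | 0 < y 0}) :
    ∃ m M : ℝ, 0 < m ∧ m ≤ M ∧ (∀ w : EuclideanSpace ℝ (Fin 4), v w ≠ 0 → m ≤ w 0 ∧ w 0 ≤ M) ∧
      tsupport (v : EuclideanSpace ℝ (Fin 4) → ℝ) ⊆ closedBall 0 M := by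
  set K := tsupport (v : EuclideanSpace ℝ (Fin 4) → ℝ) with hK_def
  have hK : IsCompact K := hc
  obtain ⟨R, hR⟩ := hK.isBounded.subset_closedBall 0
  by_cases hne : K.Nonempty
  · have hcont : ContinuousOn (fun y : EuclideanSpace ℝ (Fin 4) => y 0) K :=
      (EuclideanSpace.proj (0 : Fin 4)).continuous.continuousOn
    obtain ⟨w₀, hw₀, hmin⟩ := hK.exists_isMinOn hne hcont
    have hm0 : 0 < w₀ 0 := hpos hw₀
    refine ⟨w₀ 0, max R (w₀ 0), hm0, le_max_right _ _, fun w hw => ?_, hR.trans (closedBall_subset_closedBall (le_max_left _ _))⟩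
    have hwK : w ∈ K := subset_tsupport _ (Function.mem_support.2 hw)
    refine ⟨hmin hwK, ?_⟩
    have h1 : w ∈ closedBall (0 : EuclideanSpace ℝ (Fin 4)) R := hR hwK
    rw [mem_closedBall, dist_zero_right] at h1
    have h2 : w 0 ≤ ‖w‖ := by
      have := PiLp.norm_apply_le w (0 : Fin 4)
      rw [Real.norm_eq_abs] at this
      exact (le_abs_self _).trans this
    exact (h2.trans h1).trans (le_max_left _ _)
  · rw [not_nonempty_iff_eq_empty] at hne
    refine ⟨1, max R 1, one_pos, le_max_right _ _, fun w hw => ?_, hR.trans (closedBall_subset_closedBall (le_max_left _ _))⟩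
    have hwK : w ∈ K := subset_tsupport _ (Function.mem_support.2 hw)
    rw [hne] at hwK
    exact hwK.elim

/-- ★ **FLOOR TO AXIS in the crux's letters.**  Under the clause-(i) floor hypothesis of `RunningCouplingCeiling` (a compactly supported
positive-time `v₀` with `ε ≤ Q2_{β,L,a(β)}(θv₀, v₀)` for `β ≥ β₅`, `a(β)·L ≥ Λ₅`), with `a > 0`, `a → 0`: there are `0 < m ≤ M`,
`η > 0`, `β₀`, `Λ₀` such that for every `β ≥ β₀` (all `≥ 0`) and every torus `a(β)·L ≥ Λ₀` SOME height `t` with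
`m/a(β) − 1 ≤ t ≤ M/a(β) + 1` carries `(2t)⁸·lCC(Q^θ,Q,2t) > η` or `(2t)⁸·lCC(Q,Q^θ,2t) > η`. [cite: OsterwalderSeiler1978, §2] -/
theorem exists_axis_floor (r : LatticeRep G) (a : ℝ → ℝ) (ha : ∀ β, 0 < a β) (ha0 : Tendsto a atTop (𝓝 0))
    (hfloor : ∃ (v₀ : 𝓢(EuclideanSpace ℝ (Fin 4), ℝ)) (ε β₅ Λ₅ : ℝ),
      HasCompactSupport (v₀ : EuclideanSpace ℝ (Fin 4) → ℝ) ∧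
      tsupport (v₀ : EuclideanSpace ℝ (Fin 4) → ℝ) ⊆ {y : EuclideanSpace ℝ (Fin 4) | 0 < y 0} ∧ 0 < ε ∧
      ∀ β : ℝ, β₅ ≤ β → ∀ L : ℕ, Λ₅ ≤ a β * L → ε ≤ Q2 G r β L (a β) (thetaTest 4 v₀) v₀) :
    ∃ m M η : ℝ, 0 < m ∧ m ≤ M ∧ 0 < η ∧ ∃ β₀ Λ₀ : ℝ, 0 ≤ β₀ ∧ ∀ β : ℝ, β₀ ≤ β → ∀ L : ℕ, Λ₀ ≤ a β * L →
      ∃ t : ℕ, m / a β - 1 ≤ (t : ℝ) ∧ (t : ℝ) ≤ M / a β + 1 ∧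
        (η < ((2 * t : ℕ) : ℝ) ^ 8 * latticeConnectedCorr r.ρ β (2 * L + 1) r.curvature.timeReflect.F r.curvature.F (2 * t) ∨
         η < ((2 * t : ℕ) : ℝ) ^ 8 * latticeConnectedCorr r.ρ β (2 * L + 1) r.curvature.F r.curvature.timeReflect.F (2 * t)) := by
  obtain ⟨v₀, ε, β₅, Λ₅, hc, hpos, hε, hfl⟩ := hfloor
  obtain ⟨m, M, hm, hmM, hwin, hKM⟩ := exists_time_window_of_hasCompactSupport v₀ hc hpos
  have hθvM : tsupport (thetaTest 4 v₀ : EuclideanSpace ℝ (Fin 4) → ℝ) ⊆ closedBall 0 M :=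
    tsupport_thetaTest_subset_closedBall_zero hKM
  obtain ⟨s₁, hs₁, h₁⟩ := exists_latticeSum_abs_le v₀ hKM
  obtain ⟨s₂, hs₂, h₂⟩ := exists_latticeSum_abs_le (thetaTest 4 v₀) hθvM
  set I : ℝ := (∫ y, |v₀ y|) + 1 with hI_def
  have hI0 : 0 < I := by
    have : 0 ≤ ∫ y, |v₀ y| := integral_nonneg fun _ => abs_nonneg _
    rw [hI_def]; linarith
  -- the axis floor `η = ε m⁸ / (2 I²)`
  set η : ℝ := ε * m ^ 8 / (2 * I ^ 2) with hη_def
  have hη : 0 < η := by rw [hη_def]; positivity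
  -- thresholds: `a β ≤ s₀ = min (min s₁ s₂) (min (2m/3) 1)` eventually, tori `a β · L ≥ max Λ₅ (M + 2)`
  set s₀ : ℝ := min (min s₁ s₂) (min (2 * m / 3) 1) with hs₀_def
  have hs₀ : 0 < s₀ := lt_min (lt_min hs₁ hs₂) (lt_min (by positivity) one_pos)
  obtain ⟨β₁, hβ₁⟩ := eventually_atTop.1 (ha0.eventually (Iic_mem_nhds hs₀))
  refine ⟨m, M, η, hm, hmM, hη, max (max β₅ β₁) 0, max Λ₅ (M + 2), le_max_right _ _, ?_⟩
  intro β hβ L hL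
  have hβ5 : β₅ ≤ β := le_trans (le_trans (le_max_left _ _) (le_max_left _ _)) hβ
  have hβ1 : β₁ ≤ β := le_trans (le_trans (le_max_right _ _) (le_max_left _ _)) hβ
  have hβ0 : 0 ≤ β := le_trans (le_max_right _ _) hβ
  have has₀ : a β ≤ s₀ := hβ₁ β hβ1
  have has : 0 < a β := ha β
  have has₁ : a β ≤ s₁ := has₀.trans ((min_le_left _ _).trans (min_le_left _ _))
  have has₂ : a β ≤ s₂ := has₀.trans ((min_le_left _ _).trans (min_le_right _ _))
  have hsm : 3 * a β ≤ 2 * m := by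
    have := has₀.trans ((min_le_right _ _).trans (min_le_left _ _))
    rw [le_div_iff₀ (by norm_num : (0:ℝ) < 3)] at this
    linarith
  have ha1 : a β ≤ 1 := has₀.trans ((min_le_right _ _).trans (min_le_right _ _))
  have hΛ5 : Λ₅ ≤ a β * L := le_trans (le_max_left _ _) hL
  have hML : M + 2 ≤ a β * L := le_trans (le_max_right _ _) hL
  have hMR : M ≤ a β * L := by linarith
  have hL' : M / a β + 2 ≤ (L : ℝ) := by
    rw [div_add' _ _ _ has.ne', div_le_iff₀ has]
    nlinarith
  -- Riemann factors
  have hX : (∑ x ∈ box 4 L, |thetaTest 4 v₀ (a β • siteToE x)|) * (∑ y ∈ box 4 L, |v₀ (a β • siteToE y)|) ≤ I ^ 2 / (a β) ^ 8 := by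
    have e1 : (a β) ^ 4 * ∑ y ∈ box 4 L, |v₀ (a β • siteToE y)| ≤ I := h₁ (a β) has has₁ L hMR
    have e2 : (a β) ^ 4 * ∑ x ∈ box 4 L, |thetaTest 4 v₀ (a β • siteToE x)| ≤ I := by
      have := h₂ (a β) has has₂ L hMR
      rw [integral_abs_thetaTest] at this
      exact this
    have hX0 : 0 ≤ ∑ y ∈ box 4 L, |v₀ (a β • siteToE y)| := Finset.sum_nonneg fun _ _ => abs_nonneg _
    have hY0 : 0 ≤ ∑ x ∈ box 4 L, |thetaTest 4 v₀ (a β • siteToE x)| := Finset.sum_nonneg fun _ _ => abs_nonneg _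
    rw [le_div_iff₀ (by positivity)]
    calc (∑ x ∈ box 4 L, |thetaTest 4 v₀ (a β • siteToE x)|) * (∑ y ∈ box 4 L, |v₀ (a β • siteToE y)|) * a β ^ 8
        = ((a β) ^ 4 * ∑ x ∈ box 4 L, |thetaTest 4 v₀ (a β • siteToE x)|) *
            ((a β) ^ 4 * ∑ y ∈ box 4 L, |v₀ (a β • siteToE y)|) := by ring
      _ ≤ I * I := mul_le_mul e2 e1 (by positivity) hI0.le
      _ = I ^ 2 := by ring
  have hfv : ∀ w : EuclideanSpace ℝ (Fin 4), thetaTest 4 v₀ w ≠ 0 → -M ≤ w 0 ∧ w 0 ≤ -m := by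
    intro w hw
    rw [thetaTest_apply] at hw
    obtain ⟨h1, h2⟩ := hwin _ hw
    have h0 : timeReflection 4 w 0 = -w 0 := by simp
    rw [h0] at h1 h2
    constructor <;> linarith
  have hBε : (a β / m) ^ 8 * η * (I ^ 2 / (a β) ^ 8) < ε := by
    have hm8 : 0 < m ^ 8 := by positivity
    have e : (a β / m) ^ 8 * η * (I ^ 2 / (a β) ^ 8) = ε / 2 := by
      rw [hη_def, div_pow]
      field_simp
    rw [e]
    linarith
  exact exists_axis_floor_of_Q2_floor r hβ0 L has hm (thetaTest 4 v₀) v₀ hfv hwin hsm hL' hη.le hX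
    (hfl β hβ5 L hΛ5) hBε

end Summit.QuantumFields.YangMills.Theorems.ForcedResponseSkewnessRunningCouplingCeilingSmearScalewise

end
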